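import Literature.Computability.AlgebraicComplexity.BorderRankCW
import Literature.Computability.AlgebraicComplexity.KoszulBorderRank
import Literature.Computability.AlgebraicComplexity.BorderRankRestriction
import Literature.LinearAlgebra.Matrix.RankMinors
import HarnessLib

/-!
# Koszul flattenings of the Kronecker square of `T_{cw,q}`: explicit entries and the minor criterion

Topic: `Literature/Computability/AlgebraicComplexity`. Step 1 of the proof of the square case of
Conner–Gesmundo–Landsberg–Ventura 2022, Thm. 1.2 (`CGLV2022_thm12_square` in `BorderRankCW.lean`):
the lower bounds `bR(T_{cw,q}^{⊠2}) ≥ (q+2)²` (`q ≥ 3`) and `≥ 15` (`q = 2`) are Koszul-flattening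
bounds (CGLV §4.1: "`bR(T) ≥ rank(T_{A'}^{∧p}) / binom(2p,p)`" after a restriction
`φ : A ⊗ A → A'`, `dim A' = 2p+1`; §4.3/§4.5 for `q ≥ 4` with `p = 1`, `q = 3` "by a direct
calculation using the `p = 2` Koszul flattening", `q = 2` via Koszul flattenings, §6). This file makes
the matrices of these flattenings completely explicit and reduces each bound to the non-vanishing
of one integer minor. Everything here is **proved**; no facts.

* `cwAlpha q b c` — the unique `a` with `(T_{cw,q})_{abc} = 1`, if any (`a = 0` if `b = c ≥ 1`,
  `a = c` if `b = 0 < c`, `a = b` if `c = 0 < b`); `cwTensor_eq_ite_cwAlpha`.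
* `cwSq K q` — the Kronecker square `T_{cw,q}^{⊠2}` on pair indices `(Fin (q+1))²`;
  `algBorderRank_kroneckerPow_two_cwTensor : bR(kroneckerPow (cwTensor ℂ q) 2) = bR(cwSq ℂ q)`.
* `phiVal M j b c` — the slice entry `X_j((b,b'),(c,c')) = M_{j,(α(b,c), α(b',c'))}` of the
  restricted tensor `(M ⊗ 1 ⊗ 1) T_{cw,q}^{⊠2}` (`sum_mul_cwSq`), and the resulting ENTRY FORMULA
  `koszulFlattening_cwSq_apply` for the Koszul flattening `K_M(T_{cw,q}^{⊠2})` (any `p`, any matrix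
  `M : K^{(q+1)²} → K^{2p+1}`): `K((T,c),(S,b)) = ∑_j [T = S ⊔ j] ε(S,j) · φ_j(α(b,c), α(b',c'))`.
* `p = 2` in coordinates: `dec2`, `dec3` (the ten `2`- and `3`-subsets of `Fin 5`), the signed
  incidence table `incTab2` (`incTab2_eq`), and the fast entry function `kfast2` with
  `kfast2_eq : kfast2 M ti c si b = K_M(T_{cw,q}^{⊠2})((dec3 ti, c), (dec2 si, b))` over `ℤ`.
* `le_algBorderRank_sq_cwTensor_of_det_ne_zero` — **the minor criterion**: if some `k × k` minor of
  the integer matrix `K_M(T_{cw,q}^{⊠2})` (restriction matrix `M` with integer entries, any `p`) is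
  non-zero and `binom(2p,p) (b-1) < k`, then `b ≤ bR(T_{cw,q}^{⊠2})` over `ℂ` (Koszul bound
  `LandsbergOttaviani2015_thm21_algBorderRank`, rank via minors, base change `ℤ → ℂ`).

The certificates (explicit `M`, rows, columns and a verification that the minor is non-zero) are in
the sibling files `CwSquareFlatteningQ2.lean` (`q = 2`), `…Q3.lean` (`q = 3`) and the general-`q` file.

## References

* A. Conner, F. Gesmundo, J. M. Landsberg, E. Ventura, *Rank and border rank of Kronecker powers of
  tensors and Strassen's laser method*, comput. complexity 31 (2022), arXiv:1909.04785: Thm. 1.2 /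
  Thm. 2.1 (square case), §4.1 (Koszul flattenings, eq. (kozinq)), §4.3, §4.5, §6 (Prop. 6.2 table:
  lower bounds "obtained via Koszul flattenings"). [ConnerGesmundoLandsbergVentura2022]
* J. M. Landsberg, G. Ottaviani, Theory of Computing 11 (2015), Thm. 2.1. [LandsbergOttaviani2015]
-/

noncomputable section

open scoped BigOperators
open Matrix

namespace Literature.Computability.AlgebraicComplexity

/-! ## The support function `α` of `T_{cw,q}` -/

section Alpha

/-- `cwAlpha q b c` is the unique index `a` with `(T_{cw,q})_{abc} = 1` (`some a`), or `none` if the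
fibre `(·, b, c)` of the support is empty: `a = 0` if `b = c ≥ 1`, `a = c` if `b = 0 < c`, `a = b`
if `c = 0 < b`. [cite: ConnerGesmundoLandsbergVentura2022, eq. (1)] -/
def cwAlpha (q : ℕ) (b c : Fin (q + 1)) : Option (Fin (q + 1)) :=
  if b = c ∧ b ≠ 0 then some 0
  else if b = 0 ∧ c ≠ 0 then some c
  else if c = 0 ∧ b ≠ 0 then some b
  else none

variable (K : Type*) [CommSemiring K]

/-- `(T_{cw,q})_{abc} = [cwAlpha q b c = a]`. [cite: ConnerGesmundoLandsbergVentura2022, eq. (1)] -/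
theorem cwTensor_eq_ite_cwAlpha (q : ℕ) (a b c : Fin (q + 1)) :
    cwTensor K q a b c = if cwAlpha q b c = some a then 1 else 0 := by
  unfold cwTensor cwAlpha
  by_cases h1 : b = c ∧ b ≠ 0
  · rw [if_pos h1]
    obtain ⟨rfl, hb⟩ := h1
    by_cases ha : a = 0
    · subst ha; simp [hb]
    · rw [if_neg (by rintro (⟨h, -⟩ | ⟨h, -⟩ | ⟨h, h', -⟩) <;> simp_all), if_neg]
      simpa [eq_comm] using ha
  · rw [if_neg h1]
    by_cases h2 : b = 0 ∧ c ≠ 0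
    · rw [if_pos h2]
      obtain ⟨rfl, hc⟩ := h2
      by_cases ha : a = c
      · subst ha; simp [hc]
      · rw [if_neg (by rintro (⟨-, h, -⟩ | ⟨-, h, -⟩ | ⟨h, -, -⟩) <;> simp_all), if_neg]
        simpa [eq_comm] using ha
    · rw [if_neg h2]
      by_cases h3 : c = 0 ∧ b ≠ 0
      · rw [if_pos h3]
        obtain ⟨rfl, hb⟩ := h3
        by_cases ha : a = b
        · subst ha; simp [hb]
        · rw [if_neg (by rintro (⟨-, h, -⟩ | ⟨h, -, -⟩ | ⟨-, h, -⟩) <;> simp_all), if_neg]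
          simpa [eq_comm] using ha
      · rw [if_neg h3, if_neg (by rintro (⟨rfl, h, h'⟩ | ⟨h, rfl, h'⟩ | ⟨h, rfl, h'⟩) <;> simp_all),
          if_neg (by simp)]

end Alpha

/-! ## The Kronecker square on pair indices -/

section Square

variable (K : Type*) [CommSemiring K]

/-- `T_{cw,q}^{⊠2}` on pair indices: entry `(T_{cw,q})_{a₁b₁c₁} (T_{cw,q})_{a₂b₂c₂}` at
`((a₁,a₂),(b₁,b₂),(c₁,c₂))`. [cite: ConnerGesmundoLandsbergVentura2022, §2 (Kronecker product)] -/
def cwSq (q : ℕ) :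
    Fin (q + 1) × Fin (q + 1) → Fin (q + 1) × Fin (q + 1) → Fin (q + 1) × Fin (q + 1) → K :=
  fun a b c => cwTensor K q a.1 b.1 c.1 * cwTensor K q a.2 b.2 c.2

/-- Entries of `cwSq`. [cite: ConnerGesmundoLandsbergVentura2022, §2 (Kronecker product)] -/
@[simp] theorem cwSq_apply (q : ℕ) (a b c : Fin (q + 1) × Fin (q + 1)) :
    cwSq K q a b c = cwTensor K q a.1 b.1 c.1 * cwTensor K q a.2 b.2 c.2 := rfl

/-- `kroneckerPow (cwTensor K q) 2` is `cwSq K q` relabelled along `(Fin 2 → _) ≃ _ × _`.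
[cite: ConnerGesmundoLandsbergVentura2022, §2 (Kronecker product)] -/
theorem kroneckerPow_two_cwTensor_eq (q : ℕ) :
    kroneckerPow (cwTensor K q) 2 = fun a b c =>
      cwSq K q (finTwoArrowEquiv _ a) (finTwoArrowEquiv _ b) (finTwoArrowEquiv _ c) := by
  funext a b c
  simp [kroneckerPow_apply, Fin.prod_univ_two, finTwoArrowEquiv]

/-- `bR(T_{cw,q}^{⊠2})` may be computed on pair indices.
[cite: ConnerGesmundoLandsbergVentura2022, Thm. 1.2] -/
theorem algBorderRank_kroneckerPow_two_cwTensor (q : ℕ) :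
    algBorderRank (kroneckerPow (cwTensor ℂ q) 2) = algBorderRank (cwSq ℂ q) := by
  rw [kroneckerPow_two_cwTensor_eq]
  exact algBorderRank_reindex _ _ _ _

/-- The integer square casts to the square over any commutative ring. [folklore] -/
theorem cwSq_intCast (R : Type*) [CommRing R] (q : ℕ) (a b c : Fin (q + 1) × Fin (q + 1)) :
    ((cwSq ℤ q a b c : ℤ) : R) = cwSq R q a b c := by
  simp only [cwSq_apply, cwTensor_eq_ite_cwAlpha, Int.cast_mul]
  split_ifs <;> simp

end Square

/-! ## Slices of the restricted square and the entries of its Koszul flattenings -/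

section Entries

variable {R : Type*} [CommSemiring R] {q m : ℕ}

/-- The slice entry `X_j((b₁,b₂),(c₁,c₂)) = M_{j,(α(b₁,c₁), α(b₂,c₂))}` of
`(M ⊗ 1 ⊗ 1) T_{cw,q}^{⊠2}` (zero if one of the `α`'s is undefined).
[cite: ConnerGesmundoLandsbergVentura2022, §4.3] -/
def phiVal (M : Matrix (Fin m) (Fin (q + 1) × Fin (q + 1)) R) (j : Fin m)
    (b c : Fin (q + 1) × Fin (q + 1)) : R :=
  match cwAlpha q b.1 c.1, cwAlpha q b.2 c.2 with
  | some x, some y => M j (x, y)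
  | _, _ => 0

/-- **Slice formula**: `∑_a M_{ja} (T_{cw,q}^{⊠2})_{abc} = φ_j(α(b₁,c₁), α(b₂,c₂))`.
[cite: ConnerGesmundoLandsbergVentura2022, §4.3] -/
theorem sum_mul_cwSq (M : Matrix (Fin m) (Fin (q + 1) × Fin (q + 1)) R) (j : Fin m)
    (b c : Fin (q + 1) × Fin (q + 1)) :
    ∑ a, M j a * cwSq R q a b c = phiVal M j b c := by
  unfold phiVal
  simp only [cwSq_apply, cwTensor_eq_ite_cwAlpha]
  rcases h1 : cwAlpha q b.1 c.1 with _ | x <;> rcases h2 : cwAlpha q b.2 c.2 with _ | y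
  · simp
  · simp
  · simp
  · simp only [Option.some.injEq]
    rw [Finset.sum_eq_single (x, y)]
    · simp
    · rintro ⟨a₁, a₂⟩ - hne
      have : ¬ (x = a₁ ∧ y = a₂) := fun h => hne (by rw [h.1, h.2])
      by_cases hx : x = a₁
      · have hy : ¬ y = a₂ := fun hy => this ⟨hx, hy⟩
        simp [hy]
      · simp [hx]
    · simp

variable {S : Type*} [CommRing S]

/-- **Entry formula** for the Koszul flattening of `(M ⊗ 1 ⊗ 1) T_{cw,q}^{⊠2}` (any `p`, row
`(T, (c₁,c₂))`, column `(S, (b₁,b₂))`):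
`K = ∑_j [j ∉ S, T = S ∪ j] ε(S,j) φ_j(α(b₁,c₁), α(b₂,c₂))`.
[cite: ConnerGesmundoLandsbergVentura2022, §4.3] -/
theorem koszulFlattening_cwSq_apply (p : ℕ) (M : Matrix (Fin (2 * p + 1)) (Fin (q + 1) × Fin (q + 1)) S)
    (r : PSub (2 * p + 1) (p + 1) × (Fin (q + 1) × Fin (q + 1)))
    (c : PSub (2 * p + 1) p × (Fin (q + 1) × Fin (q + 1))) :
    koszulFlattening p M.mulVecLin (cwSq S q) r c =
      ∑ j, (if j ∉ c.1.1 ∧ r.1.1 = insert j c.1.1 then (koszulSign c.1.1 j : S) else 0) *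
        phiVal M j c.2 r.2 := by
  rw [koszulFlattening_apply, wedgeMatrix_apply]
  refine Finset.sum_congr rfl fun j _ => ?_
  split_ifs
  · rw [Matrix.mulVecLin_apply, Matrix.mulVec, dotProduct, sum_mul_cwSq]
  · rw [zero_mul]

/-- Base change `ℤ → S` of the Koszul flattening of the square.
[cite: ConnerGesmundoLandsbergVentura2022, §4.3] -/
theorem koszulFlattening_cwSq_intCast (p : ℕ) (M : Matrix (Fin (2 * p + 1)) (Fin (q + 1) × Fin (q + 1)) ℤ) :
    koszulFlattening p (M.map (Int.castRingHom S)).mulVecLin (cwSq S q) =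
      (koszulFlattening p M.mulVecLin (cwSq ℤ q)).map (Int.castRingHom S) := by
  rw [koszulFlattening_map]
  congr 1
  funext a b c
  exact (cwSq_intCast S q a b c).symm

end Entries

/-! ## `p = 2` in coordinates -/

section PTwo

/-- The ten `2`-subsets of `Fin 5`, in lexicographic order. [folklore] -/
def dec2 : Fin 10 → PSub 5 2 :=
  ![⟨{0, 1}, by decide⟩, ⟨{0, 2}, by decide⟩, ⟨{0, 3}, by decide⟩, ⟨{0, 4}, by decide⟩,
    ⟨{1, 2}, by decide⟩, ⟨{1, 3}, by decide⟩, ⟨{1, 4}, by decide⟩, ⟨{2, 3}, by decide⟩,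
    ⟨{2, 4}, by decide⟩, ⟨{3, 4}, by decide⟩]

/-- The ten `3`-subsets of `Fin 5`, in lexicographic order. [folklore] -/
def dec3 : Fin 10 → PSub 5 3 :=
  ![⟨{0, 1, 2}, by decide⟩, ⟨{0, 1, 3}, by decide⟩, ⟨{0, 1, 4}, by decide⟩, ⟨{0, 2, 3}, by decide⟩,
    ⟨{0, 2, 4}, by decide⟩, ⟨{0, 3, 4}, by decide⟩, ⟨{1, 2, 3}, by decide⟩, ⟨{1, 2, 4}, by decide⟩,
    ⟨{1, 3, 4}, by decide⟩, ⟨{2, 3, 4}, by decide⟩]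

/-- The signed incidence table of `e_j ∧ · : Λ² → Λ³` on `K⁵`: `incTab2 ti si j = ε(S,j)` if
`dec3 ti = dec2 si ∪ {j}`, `j ∉ dec2 si`, else `0`. [folklore] -/
def incTab2 : Fin 10 → Fin 10 → Fin 5 → ℤ :=
  ![![![0, 0, 1, 0, 0], ![0, -1, 0, 0, 0], ![0, 0, 0, 0, 0], ![0, 0, 0, 0, 0], ![1, 0, 0, 0, 0],
      ![0, 0, 0, 0, 0], ![0, 0, 0, 0, 0], ![0, 0, 0, 0, 0], ![0, 0, 0, 0, 0], ![0, 0, 0, 0, 0]],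
    ![![0, 0, 0, 1, 0], ![0, 0, 0, 0, 0], ![0, -1, 0, 0, 0], ![0, 0, 0, 0, 0], ![0, 0, 0, 0, 0],
      ![1, 0, 0, 0, 0], ![0, 0, 0, 0, 0], ![0, 0, 0, 0, 0], ![0, 0, 0, 0, 0], ![0, 0, 0, 0, 0]],
    ![![0, 0, 0, 0, 1], ![0, 0, 0, 0, 0], ![0, 0, 0, 0, 0], ![0, -1, 0, 0, 0], ![0, 0, 0, 0, 0],
      ![0, 0, 0, 0, 0], ![1, 0, 0, 0, 0], ![0, 0, 0, 0, 0], ![0, 0, 0, 0, 0], ![0, 0, 0, 0, 0]],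
    ![![0, 0, 0, 0, 0], ![0, 0, 0, 1, 0], ![0, 0, -1, 0, 0], ![0, 0, 0, 0, 0], ![0, 0, 0, 0, 0],
      ![0, 0, 0, 0, 0], ![0, 0, 0, 0, 0], ![1, 0, 0, 0, 0], ![0, 0, 0, 0, 0], ![0, 0, 0, 0, 0]],
    ![![0, 0, 0, 0, 0], ![0, 0, 0, 0, 1], ![0, 0, 0, 0, 0], ![0, 0, -1, 0, 0], ![0, 0, 0, 0, 0],
      ![0, 0, 0, 0, 0], ![0, 0, 0, 0, 0], ![0, 0, 0, 0, 0], ![1, 0, 0, 0, 0], ![0, 0, 0, 0, 0]],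
    ![![0, 0, 0, 0, 0], ![0, 0, 0, 0, 0], ![0, 0, 0, 0, 1], ![0, 0, 0, -1, 0], ![0, 0, 0, 0, 0],
      ![0, 0, 0, 0, 0], ![0, 0, 0, 0, 0], ![0, 0, 0, 0, 0], ![0, 0, 0, 0, 0], ![1, 0, 0, 0, 0]],
    ![![0, 0, 0, 0, 0], ![0, 0, 0, 0, 0], ![0, 0, 0, 0, 0], ![0, 0, 0, 0, 0], ![0, 0, 0, 1, 0],
      ![0, 0, -1, 0, 0], ![0, 0, 0, 0, 0], ![0, 1, 0, 0, 0], ![0, 0, 0, 0, 0], ![0, 0, 0, 0, 0]],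
    ![![0, 0, 0, 0, 0], ![0, 0, 0, 0, 0], ![0, 0, 0, 0, 0], ![0, 0, 0, 0, 0], ![0, 0, 0, 0, 1],
      ![0, 0, 0, 0, 0], ![0, 0, -1, 0, 0], ![0, 0, 0, 0, 0], ![0, 1, 0, 0, 0], ![0, 0, 0, 0, 0]],
    ![![0, 0, 0, 0, 0], ![0, 0, 0, 0, 0], ![0, 0, 0, 0, 0], ![0, 0, 0, 0, 0], ![0, 0, 0, 0, 0],
      ![0, 0, 0, 0, 1], ![0, 0, 0, -1, 0], ![0, 0, 0, 0, 0], ![0, 0, 0, 0, 0], ![0, 1, 0, 0, 0]],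
    ![![0, 0, 0, 0, 0], ![0, 0, 0, 0, 0], ![0, 0, 0, 0, 0], ![0, 0, 0, 0, 0], ![0, 0, 0, 0, 0],
      ![0, 0, 0, 0, 0], ![0, 0, 0, 0, 0], ![0, 0, 0, 0, 1], ![0, 0, 0, -1, 0], ![0, 0, 1, 0, 0]]]

/-- The table is the signed incidence of the wedge. [folklore] -/
theorem incTab2_eq : ∀ (ti si : Fin 10) (j : Fin 5),
    incTab2 ti si j =
      if j ∉ (dec2 si).1 ∧ (dec3 ti).1 = insert j (dec2 si).1 then koszulSign (dec2 si).1 j else 0 := by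
  decide

variable {q : ℕ}

/-- **Fast entry function** of the `p = 2` Koszul flattening of `(M ⊗ 1 ⊗ 1) T_{cw,q}^{⊠2}` over `ℤ`,
row `(dec3 ti, c)`, column `(dec2 si, b)`: a five-term signed sum of `φ`-values (no `Finset`
bookkeeping, for kernel evaluation). [cite: ConnerGesmundoLandsbergVentura2022, §4.3] -/
def kfast2 (M : Matrix (Fin 5) (Fin (q + 1) × Fin (q + 1)) ℤ) (ti : Fin 10)
    (c : Fin (q + 1) × Fin (q + 1)) (si : Fin 10) (b : Fin (q + 1) × Fin (q + 1)) : ℤ :=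
  ∑ j : Fin 5, incTab2 ti si j * phiVal M j b c

/-- `kfast2` computes the entries of the Koszul flattening.
[cite: ConnerGesmundoLandsbergVentura2022, §4.3] -/
theorem kfast2_eq (M : Matrix (Fin 5) (Fin (q + 1) × Fin (q + 1)) ℤ) (ti : Fin 10)
    (c : Fin (q + 1) × Fin (q + 1)) (si : Fin 10) (b : Fin (q + 1) × Fin (q + 1)) :
    kfast2 M ti c si b = koszulFlattening 2 M.mulVecLin (cwSq ℤ q) (dec3 ti, c) (dec2 si, b) := by
  rw [kfast2, koszulFlattening_cwSq_apply]
  refine Finset.sum_congr rfl fun j _ => ?_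
  rw [incTab2_eq]
  split_ifs <;> simp

end PTwo

/-! ## The minor criterion -/

section Minor

variable {q : ℕ}

/-- A non-zero `k × k` minor of an integer matrix gives rank `≥ k` over `ℂ`. [folklore] -/
theorem le_rank_map_intCast_of_det_ne_zero {m n : Type*} [Fintype m] [Fintype n] [DecidableEq n]
    {k : ℕ} (A : Matrix m n ℤ) (r : Fin k → m) (c : Fin k → n) (h : (A.submatrix r c).det ≠ 0) :
    k ≤ (A.map (Int.castRingHom ℂ)).rank := by
  have h' : ((A.map (Int.castRingHom ℂ)).submatrix r c).det ≠ 0 := by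
    rw [show (A.map (Int.castRingHom ℂ)).submatrix r c =
      (Int.castRingHom ℂ).mapMatrix (A.submatrix r c) from rfl, ← RingHom.map_det, eq_intCast]
    exact_mod_cast h
  simpa using
    Literature.LinearAlgebra.Matrix.card_le_rank_of_det_submatrix_ne_zero _ r c h'

/-- **The minor criterion.** Let `M` be an integer `(2p+1) × (q+1)²` restriction matrix. If some
`k × k` minor of the integer Koszul flattening `K_M(T_{cw,q}^{⊠2})` is non-zero and
`binom(2p,p) · (b - 1) < k`, then `b ≤ bR(T_{cw,q}^{⊠2})` (border rank over `ℂ[ε]`): the Koszul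
bound `rank ≤ binom(2p,p) bR` (Landsberg–Ottaviani) applied to the base-changed flattening, whose
rank is at least `k`. [cite: ConnerGesmundoLandsbergVentura2022, §4.1 eq. (kozinq)] -/
theorem le_algBorderRank_sq_cwTensor_of_det_ne_zero (p : ℕ)
    (M : Matrix (Fin (2 * p + 1)) (Fin (q + 1) × Fin (q + 1)) ℤ) {k : ℕ}
    (r : Fin k → PSub (2 * p + 1) (p + 1) × (Fin (q + 1) × Fin (q + 1)))
    (c : Fin k → PSub (2 * p + 1) p × (Fin (q + 1) × Fin (q + 1)))
    (hdet : ((koszulFlattening p M.mulVecLin (cwSq ℤ q)).submatrix r c).det ≠ 0) {b : ℕ}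
    (hb : (2 * p).choose p * (b - 1) < k) :
    b ≤ algBorderRank (kroneckerPow (cwTensor ℂ q) 2) := by
  rw [algBorderRank_kroneckerPow_two_cwTensor]
  have hk : k ≤ (koszulFlattening p (M.map (Int.castRingHom ℂ)).mulVecLin (cwSq ℂ q)).rank := by
    rw [koszulFlattening_cwSq_intCast]
    exact le_rank_map_intCast_of_det_ne_zero _ r c hdet
  have hKB := LandsbergOttaviani2015_thm21_algBorderRank p
    (M.map (Int.castRingHom ℂ)).mulVecLin (cwSq ℂ q)
  have hpos : 0 < (2 * p).choose p := Nat.choose_pos (by omega)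
  have h := (hb.trans_le hk).trans_le hKB
  have := Nat.lt_of_mul_lt_mul_left h
  omega

end Minor

end Literature.Computability.AlgebraicComplexity

end
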